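import Literature.Probability.Percolation.TranslateChaining
import Literature.Probability.Percolation.CornerPercolation
import HarnessLib

/-!
# Good shifts: Bollobás–Riordan's chaining count with the constants of line `Sketch`
# (crux stmt-CriticalPhenomena-5476 `UniformBoxCrossing`)

Bollobás–Riordan, *Percolation on self-dual polygon configurations* (2010, arXiv:1001.4674),
§5.1, proof of Theorem 5.3, pp. 23–24, in the tree's abstract form
`exists_translates_linking_strip` (`TranslateChaining.lean`), specialised to the integer
constants used by the reshaped engine of line `Sketch`:

* base unit `k ≥ 1`; strip / lower square width `n = 32000 k`; upper square shifted by `s = k`,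
  so "strictly above `S₂`" starts at height `32001 k + 1`;
* the non-slant path lives in the small square `[0, 1600 k]²` (`m = n / 20`), from its bottom
  side to its top side, with endpoint abscissae differing by at most `3m/5 = 960 k`;
* the square of starting points `R₀` has side `r = 4000 k` (`γ = 1/8`) and sits just below
  `S₁` (`y₀ = -4000 k - 1`), at abscissa `x₀ = 1600 k` if the path drifts to the right and
  `x₀ = 26400 k` if it drifts to the left (B–R's two choices of `v₀`);
* `I = 23` links (`23 · 1600 k ≥ 32001 k + 1 + 4000 k + 1`);
* gap bound `#G ≤ 360000 k²` (`ε n²`), giving `#Xs ≥ ((4000k+1)² - 22 · 360000 k²)/23 ≥ 350000 k²`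
  good translation vectors, all in the window `[-1600k, 32000k] × [-5600k - 1, 36800k - 1]`.

`goodShifts` is consumed by the assembly of the engine (the translation vector `X` is sampled
uniformly from that window; for `X ∈ Xs` the translated path starts in `A`, ends in `B` and stays
in the strip).
-/

namespace Summit.CriticalPhenomena.CardyFormulaZ2.Cruxes.UniformBoxCrossing.NonSlantLine

open Literature.Probability.Percolation Literature.Probability.LatticeModels

/-- **Good shifts** (Bollobás–Riordan 2010, proof of Thm. 5.3, the bound `Pr(X ∈ C'_i) ≥ γ²α/400`,
with the constants of line `Sketch`). Let `k ≥ 1`, let `A`, `B` be sets of lattice points and `G`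
a finite set such that, in the strip `0 ≤ z₀ ≤ 32000k`, every point below height `0` is in `A`,
every point at height `≥ 32001k + 1` is in `B`, every point is in `A ∪ B ∪ G`, and
`#G ≤ 360000 k²`. Let `W` be a lattice walk inside `[0, 1600k]²` from a bottom vertex `x` to a
top vertex `y` with `5 |y₀ - x₀| ≤ 3 · 1600k`. Then at least `350000 k²` translation vectors `X`
in the window `[-1600k, 32000k] × [-5600k-1, 36800k-1]` have `x + X ∈ A`, `y + X ∈ B` and
`W + X` inside the strip. [cite: BollobasRiordan2010, §5.1 proof of Thm. 5.3] -/
theorem goodShifts (k : ℕ) (hk : 1 ≤ k) (A B : Set (Site 2)) (G : Finset (Site 2))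
    (hAlow : ∀ z : Site 2, 0 ≤ z 0 → z 0 ≤ (32000 * k : ℕ) → z 1 < 0 → z ∈ A)
    (hBhigh : ∀ z : Site 2, 0 ≤ z 0 → z 0 ≤ (32000 * k : ℕ) → (32001 * k + 1 : ℤ) ≤ z 1 → z ∈ B)
    (hcover : ∀ z : Site 2, 0 ≤ z 0 → z 0 ≤ (32000 * k : ℕ) → z ∈ A ∨ z ∈ B ∨ z ∈ G)
    (hG : G.card ≤ 360000 * k ^ 2)
    {x y : Site 2} (W : (zdGraph 2).Walk x y) (hx : x ∈ bottomSide (1600 * k) (1600 * k))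
    (hy : y ∈ topSide (1600 * k) (1600 * k)) (hslant : 5 * |y 0 - x 0| ≤ 3 * ((1600 * k : ℕ) : ℤ))
    (hW : ∀ z ∈ W.support, z ∈ rectangle (1600 * k) (1600 * k)) :
    ∃ Xs : Finset (Site 2),
      (∀ X ∈ Xs, -((1600 * k : ℕ) : ℤ) ≤ X 0 ∧ X 0 ≤ (32000 * k : ℕ) ∧
        -(4000 * k : ℤ) - 1 - (1600 * k : ℕ) ≤ X 1 ∧ X 1 ≤ -(4000 * k : ℤ) - 1 + (4000 * k : ℕ) + 23 * (y 1 - x 1)) ∧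
      (∀ X ∈ Xs, x + X ∈ A ∧ y + X ∈ B ∧ ∀ z ∈ W.support, 0 ≤ (z + X) 0 ∧ (z + X) 0 ≤ (32000 * k : ℕ)) ∧
      350000 * k ^ 2 ≤ Xs.card := by
  classical
  -- the data of the small square
  simp only [bottomSide, topSide, Finset.mem_filter, mem_rectangle_iff] at hx hy
  set P : Finset (Site 2) := W.support.toFinset with hPdef
  have hPmem : ∀ z, z ∈ P ↔ z ∈ W.support := fun z => by rw [hPdef, List.mem_toFinset]
  have hP : ∀ z ∈ P, 0 ≤ z 0 ∧ z 0 ≤ ((1600 * k : ℕ) : ℤ) ∧ 0 ≤ z 1 ∧ z 1 ≤ ((1600 * k : ℕ) : ℤ) :=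
    fun z hz => mem_rectangle_iff.1 (hW z ((hPmem z).1 hz))
  have hxP : x ∈ P := (hPmem x).2 W.start_mem_support
  have hd : |y 0 - x 0| ≤ 960 * k := by
    have : ((1600 * k : ℕ) : ℤ) = 1600 * k := by push_cast; ring
    rw [this] at hslant
    omega
  -- B–R's choice of the abscissa of `R₀` according to the sign of the drift
  set x₀ : ℕ := if x 0 ≤ y 0 then 1600 * k else 26400 * k with hx₀
  have hx₀cases : (x 0 ≤ y 0 ∧ x₀ = 1600 * k) ∨ (y 0 < x 0 ∧ x₀ = 26400 * k) := by
    by_cases h : x 0 ≤ y 0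
    · exact Or.inl ⟨h, by rw [hx₀, if_pos h]⟩
    · exact Or.inr ⟨lt_of_not_ge h, by rw [hx₀, if_neg h]⟩
  have habs := abs_le.1 hd
  obtain ⟨Xs, hwin, hgood, hcount⟩ := exists_translates_linking_strip (32000 * k) A B G
    (32001 * k + 1) hAlow hBhigh hcover P (1600 * k) (1600 * k) hP (s := x) (e := y) hxP
    (by rw [hx.2]; exact hy.1.2.2.1) x₀ (4000 * k) (-(4000 * k : ℤ) - 1) (by push_cast; omega)
    (I := 23) (by norm_num)
    (by rw [hx.2, hy.2]; push_cast; omega)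
    (by rcases hx₀cases with ⟨h, h'⟩ | ⟨h, h'⟩ <;> (push_cast; omega))
    (by rcases hx₀cases with ⟨h, h'⟩ | ⟨h, h'⟩ <;> (push_cast; omega))
    (by rcases hx₀cases with ⟨h, h'⟩ | ⟨h, h'⟩ <;> (push_cast; omega))
    (by rcases hx₀cases with ⟨h, h'⟩ | ⟨h, h'⟩ <;> (push_cast; omega))
  refine ⟨Xs, fun X hX => ?_, fun X hX => ?_, ?_⟩
  · have h := hwin X hX
    refine ⟨h.1, h.2.1, ?_, ?_⟩
    · have := h.2.2.1; push_cast at this ⊢; omega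
    · have := h.2.2.2; push_cast at this ⊢; omega
  · obtain ⟨hA, hB, hT⟩ := hgood X hX
    exact ⟨hA, hB, fun z hz => hT z ((hPmem z).2 hz)⟩
  · -- `(4000k + 1)² ≤ 23 #Xs + 22 #G` and `#G ≤ 360000 k²`
    have h1 : (4000 * k + 1) ^ 2 ≤ 23 * Xs.card + 22 * G.card := by
      have := hcount; norm_num at this; exact this
    nlinarith [hG, h1]

/-- Statement form of `goodShifts`: a registered step the LINE POSITS and proves right below
(`goodShifts_holds`); not a literature fact, never to be relocated. -/
def GoodShiftsStatement : Prop :=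
  ∀ (k : ℕ), 1 ≤ k → ∀ (A B : Set (Site 2)) (G : Finset (Site 2)),
    (∀ z : Site 2, 0 ≤ z 0 → z 0 ≤ (32000 * k : ℕ) → z 1 < 0 → z ∈ A) →
    (∀ z : Site 2, 0 ≤ z 0 → z 0 ≤ (32000 * k : ℕ) → (32001 * k + 1 : ℤ) ≤ z 1 → z ∈ B) →
    (∀ z : Site 2, 0 ≤ z 0 → z 0 ≤ (32000 * k : ℕ) → z ∈ A ∨ z ∈ B ∨ z ∈ G) →
    G.card ≤ 360000 * k ^ 2 →
    ∀ (x y : Site 2) (W : (zdGraph 2).Walk x y), x ∈ bottomSide (1600 * k) (1600 * k) →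
      y ∈ topSide (1600 * k) (1600 * k) → 5 * |y 0 - x 0| ≤ 3 * ((1600 * k : ℕ) : ℤ) →
      (∀ z ∈ W.support, z ∈ rectangle (1600 * k) (1600 * k)) →
      ∃ Xs : Finset (Site 2),
        (∀ X ∈ Xs, -((1600 * k : ℕ) : ℤ) ≤ X 0 ∧ X 0 ≤ (32000 * k : ℕ) ∧
          -(4000 * k : ℤ) - 1 - (1600 * k : ℕ) ≤ X 1 ∧ X 1 ≤ -(4000 * k : ℤ) - 1 + (4000 * k : ℕ) + 23 * (y 1 - x 1)) ∧
        (∀ X ∈ Xs, x + X ∈ A ∧ y + X ∈ B ∧ ∀ z ∈ W.support, 0 ≤ (z + X) 0 ∧ (z + X) 0 ≤ (32000 * k : ℕ)) ∧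
        350000 * k ^ 2 ≤ Xs.card

/-- Good shifts, statement form. [cite: BollobasRiordan2010, §5.1 proof of Thm. 5.3] -/
theorem goodShifts_holds : GoodShiftsStatement :=
  fun k hk A B G hAlow hBhigh hcover hG _ _ W hx hy hslant hW =>
    goodShifts k hk A B G hAlow hBhigh hcover hG W hx hy hslant hW

end Summit.CriticalPhenomena.CardyFormulaZ2.Cruxes.UniformBoxCrossing.NonSlantLine
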